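import Summits.ResolutionOfSingularities.ResolutionOfSingularities.Theorems.RadicialJungCleanModelsReadOffCriticalReader
import Literature.AlgebraicGeometry.Resolution.DualDerivationsPrimeField
import Literature.AlgebraicGeometry.Resolution.FormalNormalCrossingsAlgebra
import Literature.AlgebraicGeometry.Resolution.RegularLocalRingsProofs
import HarnessLib

/-!
# [OURS · L W8.1 · T2 brick B7, PART (3), landing 2] A REALISER `f − gᵖ = u·x^a·y^b` with `x^a y^b ∈ J(O, f; log x, y)` puts `f` in
# Giraud's normal form — the `I_g` computation (F-96-free)

Programme `PROGRAMME-clean-dim2` / T2 (res-L0-w81-pv-2 g5), spec `HOME/L/res-L0-w81-pv-2/g5/B7-SPEC.md` §(3); crux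
`stmt-ResolutionOfSingularities-0549`, stub `stub_cleanModels` (= stmt-…-15917); `--supports … --as helper` by res-L1-s13-pv-1 g7 (custody DEAL #63 (1)).
OURS; nothing here is a statement of H. Hironaka's manuscript; AI-written, weaker than expert review.

`O` regular local of dimension `2`, an `𝔽_p`-algebra formally smooth over `𝔽_p` (every local ring of a regular variety over a field of
characteristic `p`), `(x, y)` a regular system of parameters, `∂ₓ, ∂_y` DUAL derivations (`exists_dual_derivations_int`).  For `f = gᵖ + u·x^a·y^b`
and a derivation `D` LOGARITHMIC along `x, y` (`D x = x·α`, `D y = y·β`) one has `D(gᵖ) = 0` and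
`D f = x^a y^b · (D u + a·α·u + b·β·u)`, and `D u + aαu + bβu = α·(a u + x∂ₓu) + β·(b u + y∂_y u) + D₀ u` with `D₀ := D − αx∂ₓ − βy∂_y`
killing `x` and `y`.  Hence `J(O, f; log x, y) ⊆ x^a y^b · I_g`, `I_g := (a u + x∂ₓu, b u + y∂_y u) + {D₀ u : D₀ x = D₀ y = 0}`, and if
`x^a y^b ∈ J(O, f; log x, y)` (the reading of «(*) and `c = 0`»: `J = (x^a y^b)`, parts (1)–(2) of the spec) then `1 ∈ I_g`, so ONE generator
of `I_g` is a unit and landing 1 (`…ReadOffCriticalReader`, this seat) gives (c-1) or (c-2).  Non-crossing: the same with `J(O, f; log x)`,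
`f = gᵖ + u·x^a`, `I_g = (a u + x∂ₓu, ∂_y u) + {D₀ u}`.

* `derivation_apply_pow_char` — `D(gᵖ) = 0`; `derivation_apply_realiser` (+ `₁`) — the displayed formula for `D f`;
* `exists_unit_generator_of_mem_span` (+ `₁`) — `x^a y^b ∈ J(O,f;log x,y)` ⇒ a unit among `a u + x∂ₓu`, `b u + y∂_y u`, `D₀ u`;
* **`giraud15NormalFormAt_crossing_of_realiser`**, **`giraud15NormalFormAt_noncrossing_of_realiser`** — the spec's «∃ g realising both maxima
  ⇒ B7», in the form: `f = gᵖ + u·x^a·y^b` (`a, b ≥ 2`) with `x^a y^b ∈ J(O, f; log x, y)` ⇒ `Giraud15NormalFormAt p f` (resp. `r = 1`).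
-/

set_option linter.dupNamespace false -- mandated namespace `Summit.<Summit>.<Problem>` of this single-conjunct summit

noncomputable section

open IsLocalRing
open Literature.AlgebraicGeometry.Resolution

namespace Summit.ResolutionOfSingularities.ResolutionOfSingularities.Theorems.RadicialJung.CleanModels

universe u

/-! ## § 1 Derivations of an `𝔽_p`-algebra kill `p`-th powers; the value of a logarithmic derivation on a realiser -/

/-- `D(gᵖ) = 0` in characteristic `p`. [folklore] -/
theorem derivation_apply_pow_char {O : Type u} [CommRing O] (p : ℕ) [CharP O p] (D : Derivation ℤ O O) (g : O) : D (g ^ p) = 0 := by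
  rw [Derivation.leibniz_pow, nsmul_eq_mul, CharP.cast_eq_zero, zero_mul]

/-- **The value of a logarithmic derivation on a realiser** (crossing): `D x = x·α`, `D y = y·β`, `f = gᵖ + u·x^a·y^b`, `a, b ≥ 1` ⇒
`D f = x^a y^b · (D u + a·α·u + b·β·u)`. [folklore] -/
theorem derivation_apply_realiser {O : Type u} [CommRing O] (p : ℕ) [CharP O p] (D : Derivation ℤ O O) {x y f g u α β : O}
    {a b : ℕ} (ha : 1 ≤ a) (hb : 1 ≤ b) (hf : f = g ^ p + u * (x ^ a * y ^ b)) (hDx : D x = x * α) (hDy : D y = y * β) :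
    D f = x ^ a * y ^ b * (D u + (a : O) * α * u + (b : O) * β * u) := by
  obtain ⟨a', rfl⟩ : ∃ a', a = a' + 1 := ⟨a - 1, by omega⟩
  obtain ⟨b', rfl⟩ : ∃ b', b = b' + 1 := ⟨b - 1, by omega⟩
  rw [hf, map_add, derivation_apply_pow_char p D g, zero_add, Derivation.leibniz, Derivation.leibniz, Derivation.leibniz_pow,
    Derivation.leibniz_pow, hDx, hDy]
  simp only [smul_eq_mul, nsmul_eq_mul, Nat.add_sub_cancel, Nat.cast_add, Nat.cast_one]
  ring

/-- The same, non-crossing: `D x = x·α`, `f = gᵖ + u·x^a`, `a ≥ 1` ⇒ `D f = x^a · (D u + a·α·u)`. [folklore] -/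
theorem derivation_apply_realiser₁ {O : Type u} [CommRing O] (p : ℕ) [CharP O p] (D : Derivation ℤ O O) {x f g u α : O} {a : ℕ}
    (ha : 1 ≤ a) (hf : f = g ^ p + u * x ^ a) (hDx : D x = x * α) : D f = x ^ a * (D u + (a : O) * α * u) := by
  obtain ⟨a', rfl⟩ : ∃ a', a = a' + 1 := ⟨a - 1, by omega⟩
  rw [hf, map_add, derivation_apply_pow_char p D g, zero_add, Derivation.leibniz, Derivation.leibniz_pow, hDx]
  simp only [smul_eq_mul, nsmul_eq_mul, Nat.add_sub_cancel, Nat.cast_add, Nat.cast_one]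
  ring

/-! ## § 2 `x^a y^b ∈ J(O, f; log x, y)` forces a unit generator of `I_g` -/

section Regular

/-- Dual derivations of a regular system of parameters `(x, y)` of a 2-dimensional regular local `𝔽_p`-algebra formally smooth over `𝔽_p`:
`∂ₓ x = 1`, `∂ₓ y = 0`, `∂_y x = 0`, `∂_y y = 1`. [cite: Matsumura1987, Thm. 30.6 (ii)] -/
theorem exists_dual_pair (p : ℕ) [Fact p.Prime] {O : Type u} [CommRing O] [IsRegularLocalRing O] [Algebra (ZMod p) O]
    [Algebra.FormallySmooth (ZMod p) O] (hdim : ringKrullDim O = 2) {x y : O} (hxy : Ideal.span {x, y} = maximalIdeal O) :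
    ∃ δ₀ δ₁ : Derivation ℤ O O, δ₀ x = 1 ∧ δ₀ y = 0 ∧ δ₁ x = 0 ∧ δ₁ y = 1 := by
  classical
  have hspan : Ideal.span (Set.range ![x, y]) = maximalIdeal O := by
    rw [← hxy, Matrix.range_cons, Matrix.range_cons, Matrix.range_empty, Set.union_empty, Set.singleton_union]
  have hdim' : ringKrullDim O = ((2 : ℕ) : WithBot ℕ∞) := hdim
  have hli := linearIndependent_toCotangent_of_span_eq_maximalIdeal hdim' ![x, y] hspan
  have hmem : ∀ i, (![x, y] : Fin 2 → O) i ∈ maximalIdeal O := fun i => hspan ▸ Ideal.subset_span ⟨i, rfl⟩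
  obtain ⟨δ, hδ⟩ := exists_dual_derivations_int p ![x, y] hmem hli
  refine ⟨δ 0, δ 1, ?_, ?_, ?_, ?_⟩
  · simpa using hδ 0 0
  · simpa using hδ 0 1
  · simpa using hδ 1 0
  · simpa using hδ 1 1

/-- **`x^a y^b ∈ J(O, f; log x, y)` ⇒ a UNIT among the generators of `I_g`** (crossing; `f = gᵖ + u·x^a·y^b`, `a, b ≥ 1`; `∂ₓ, ∂_y` dual):
`a u + x∂ₓu` or `b u + y∂_y u` is a unit, or some derivation killing `x` and `y` has a unit value on `u`. [cite: Giraud1983, Prop. 1.5, §1.4] -/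
theorem exists_unit_generator_of_mem_span (p : ℕ) [Fact p.Prime] {O : Type u} [CommRing O] [IsLocalRing O] [IsDomain O] [Algebra (ZMod p) O] {x y f g u : O} {a b : ℕ} (ha : 1 ≤ a) (hb : 1 ≤ b)
    (hf : f = g ^ p + u * (x ^ a * y ^ b)) (hx0 : x ≠ 0) (hy0 : y ≠ 0) (δ₀ δ₁ : Derivation ℤ O O)
    (h₀x : δ₀ x = 1) (h₀y : δ₀ y = 0) (h₁x : δ₁ x = 0) (h₁y : δ₁ y = 1)
    (hJ : x ^ a * y ^ b ∈ Ideal.span {v : O | ∃ D : Derivation ℤ O O, x ∣ D x ∧ y ∣ D y ∧ D f = v}) :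
    IsUnit ((a : O) * u + x * δ₀ u) ∨ IsUnit ((b : O) * u + y * δ₁ u) ∨
      ∃ D₀ : Derivation ℤ O O, D₀ x = 0 ∧ D₀ y = 0 ∧ D₀ u ∉ maximalIdeal O := by
  haveI : CharP O p := charP_of_injective_algebraMap (algebraMap (ZMod p) O).injective p
  -- `I_g`
  set I : Ideal O := Ideal.span {(a : O) * u + x * δ₀ u, (b : O) * u + y * δ₁ u} ⊔
    Ideal.span {v : O | ∃ D₀ : Derivation ℤ O O, D₀ x = 0 ∧ D₀ y = 0 ∧ D₀ u = v} with hI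
  -- every generator of `J(O,f;log x,y)` lies in `x^a y^b · I`
  have hgen : ∀ v ∈ {v : O | ∃ D : Derivation ℤ O O, x ∣ D x ∧ y ∣ D y ∧ D f = v}, v ∈ Ideal.span {x ^ a * y ^ b} * I := by
    rintro v ⟨D, ⟨α, hα⟩, ⟨β, hβ⟩, rfl⟩
    rw [derivation_apply_realiser p D ha hb hf hα hβ]
    refine Ideal.mul_mem_mul (Ideal.mem_span_singleton_self _) ?_
    -- `D u + aαu + bβu = α (a u + x∂ₓu) + β (b u + y∂_y u) + D₀ u`
    let D₀ : Derivation ℤ O O := D - (α * x) • δ₀ - (β * y) • δ₁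
    have hD₀x : D₀ x = 0 := by
      simp only [D₀, Derivation.sub_apply, Derivation.smul_apply, smul_eq_mul, hα, h₀x, h₁x]; ring
    have hD₀y : D₀ y = 0 := by
      simp only [D₀, Derivation.sub_apply, Derivation.smul_apply, smul_eq_mul, hβ, h₀y, h₁y]; ring
    have hdec : D u + (a : O) * α * u + (b : O) * β * u =
        α * ((a : O) * u + x * δ₀ u) + β * ((b : O) * u + y * δ₁ u) + D₀ u := by
      simp only [D₀, Derivation.sub_apply, Derivation.smul_apply, smul_eq_mul]; ring
    rw [hdec]
    refine Ideal.add_mem _ (Ideal.mem_sup_left (Ideal.add_mem _ (Ideal.mul_mem_left _ _ (Ideal.subset_span (by simp)))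
      (Ideal.mul_mem_left _ _ (Ideal.subset_span (by simp))))) (Ideal.mem_sup_right (Ideal.subset_span ⟨D₀, hD₀x, hD₀y, rfl⟩))
  have hle : Ideal.span {v : O | ∃ D : Derivation ℤ O O, x ∣ D x ∧ y ∣ D y ∧ D f = v} ≤ Ideal.span {x ^ a * y ^ b} * I :=
    Ideal.span_le.mpr hgen
  -- hence `x^a y^b = x^a y^b · i` with `i ∈ I`, so `1 ∈ I`
  obtain ⟨i, hi, hxi⟩ := Ideal.mem_span_singleton_mul.mp (hle hJ)
  have hxy0 : x ^ a * y ^ b ≠ 0 := mul_ne_zero (pow_ne_zero _ hx0) (pow_ne_zero _ hy0)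
  have hi1 : i = 1 := by
    have : x ^ a * y ^ b * (i - 1) = 0 := by rw [mul_sub, hxi, mul_one, sub_self]
    exact sub_eq_zero.mp ((mul_eq_zero.mp this).resolve_left hxy0)
  have hItop : I = ⊤ := (Ideal.eq_top_iff_one _).mpr (hi1 ▸ hi)
  -- a local ring: some generator is a unit
  by_contra hcon
  push Not at hcon
  obtain ⟨h1, h2, h3⟩ := hcon
  have hIle : I ≤ maximalIdeal O := by
    rw [hI]
    refine sup_le (Ideal.span_le.mpr ?_) (Ideal.span_le.mpr ?_)
    · rintro v (rfl | rfl)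
      · exact (mem_maximalIdeal _).mpr h1
      · exact (mem_maximalIdeal _).mpr h2
    · rintro v ⟨D₀, hD₀x, hD₀y, rfl⟩
      exact h3 D₀ hD₀x hD₀y
  exact (maximalIdeal.isMaximal O).ne_top (top_le_iff.mp (hItop ▸ hIle))

/-- The same, non-crossing (`f = gᵖ + u·x^a`, `x^a ∈ J(O, f; log x)`): `a u + x∂ₓu` or `∂_y u` is a unit, or some derivation killing `x` and
`y` has a unit value on `u`. [cite: Giraud1983, Prop. 1.5, §1.4] -/
theorem exists_unit_generator_of_mem_span₁ (p : ℕ) [Fact p.Prime] {O : Type u} [CommRing O] [IsLocalRing O] [IsDomain O] [Algebra (ZMod p) O] {x y f g u : O} {a : ℕ} (ha : 1 ≤ a) (hf : f = g ^ p + u * x ^ a) (hx0 : x ≠ 0)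
    (δ₀ δ₁ : Derivation ℤ O O) (h₀x : δ₀ x = 1) (h₁x : δ₁ x = 0) (h₁y : δ₁ y = 1)
    (hJ : x ^ a ∈ Ideal.span {v : O | ∃ D : Derivation ℤ O O, x ∣ D x ∧ D f = v}) :
    IsUnit ((a : O) * u + x * δ₀ u) ∨ δ₁ u ∉ maximalIdeal O ∨
      ∃ D₀ : Derivation ℤ O O, D₀ x = 0 ∧ D₀ y = 0 ∧ D₀ u ∉ maximalIdeal O := by
  haveI : CharP O p := charP_of_injective_algebraMap (algebraMap (ZMod p) O).injective p
  set I : Ideal O := Ideal.span {(a : O) * u + x * δ₀ u, δ₁ u} ⊔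
    Ideal.span {v : O | ∃ D₀ : Derivation ℤ O O, D₀ x = 0 ∧ D₀ y = 0 ∧ D₀ u = v} with hI
  have hgen : ∀ v ∈ {v : O | ∃ D : Derivation ℤ O O, x ∣ D x ∧ D f = v}, v ∈ Ideal.span {x ^ a} * I := by
    rintro v ⟨D, ⟨α, hα⟩, rfl⟩
    rw [derivation_apply_realiser₁ p D ha hf hα]
    refine Ideal.mul_mem_mul (Ideal.mem_span_singleton_self _) ?_
    let D₀ : Derivation ℤ O O := D - (α * x) • δ₀ - (D y - α * x * δ₀ y) • δ₁
    have hD₀x : D₀ x = 0 := by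
      simp only [D₀, Derivation.sub_apply, Derivation.smul_apply, smul_eq_mul, hα, h₀x, h₁x]; ring
    have hD₀y : D₀ y = 0 := by
      simp only [D₀, Derivation.sub_apply, Derivation.smul_apply, smul_eq_mul, h₁y]; ring
    have hdec : D u + (a : O) * α * u =
        α * ((a : O) * u + x * δ₀ u) + (D y - α * x * δ₀ y) * δ₁ u + D₀ u := by
      simp only [D₀, Derivation.sub_apply, Derivation.smul_apply, smul_eq_mul]; ring
    rw [hdec]
    refine Ideal.add_mem _ (Ideal.mem_sup_left (Ideal.add_mem _ (Ideal.mul_mem_left _ _ (Ideal.subset_span (by simp)))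
      (Ideal.mul_mem_left _ _ (Ideal.subset_span (by simp))))) (Ideal.mem_sup_right (Ideal.subset_span ⟨D₀, hD₀x, hD₀y, rfl⟩))
  have hle : Ideal.span {v : O | ∃ D : Derivation ℤ O O, x ∣ D x ∧ D f = v} ≤ Ideal.span {x ^ a} * I := Ideal.span_le.mpr hgen
  obtain ⟨i, hi, hxi⟩ := Ideal.mem_span_singleton_mul.mp (hle hJ)
  have hi1 : i = 1 := by
    have : x ^ a * (i - 1) = 0 := by rw [mul_sub, hxi, mul_one, sub_self]
    exact sub_eq_zero.mp ((mul_eq_zero.mp this).resolve_left (pow_ne_zero _ hx0))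
  have hItop : I = ⊤ := (Ideal.eq_top_iff_one _).mpr (hi1 ▸ hi)
  by_contra hcon
  push Not at hcon
  obtain ⟨h1, h2, h3⟩ := hcon
  have hIle : I ≤ maximalIdeal O := by
    rw [hI]
    refine sup_le (Ideal.span_le.mpr ?_) (Ideal.span_le.mpr ?_)
    · rintro v (rfl | rfl)
      · exact (mem_maximalIdeal _).mpr h1
      · exact h2
    · rintro v ⟨D₀, hD₀x, hD₀y, rfl⟩
      exact h3 D₀ hD₀x hD₀y
  exact (maximalIdeal.isMaximal O).ne_top (top_le_iff.mp (hItop ▸ hIle))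

/-! ## § 3 The realiser theorems -/

/-- **B7 PART (3), crossing: a realiser puts `f` in Giraud normal form.** `O` regular local of dimension `2`, formally smooth over `𝔽_p`;
`(x, y)` a regular system of parameters; `f = gᵖ + u·x^a·y^b` with `a, b ≥ 2` and `x^a y^b ∈ J(O, f; log x, y)` (the «(*) ∧ c = 0» reading)
⇒ `Giraud15NormalFormAt p f`. [cite: Giraud1983, Prop. 1.5 (i) ⇒ (ii), §1.4] -/
theorem giraud15NormalFormAt_crossing_of_realiser (p : ℕ) [Fact p.Prime] {O : Type u} [CommRing O] [IsRegularLocalRing O] [Algebra (ZMod p) O]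
    [Algebra.FormallySmooth (ZMod p) O] (hdim : ringKrullDim O = 2) {x y f g u : O} {a b : ℕ}
    (hxy : Ideal.span {x, y} = maximalIdeal O) (hf : f = g ^ p + u * (x ^ a * y ^ b)) (ha : 2 ≤ a) (hb : 2 ≤ b)
    (hJ : x ^ a * y ^ b ∈ Ideal.span {v : O | ∃ D : Derivation ℤ O O, x ∣ D x ∧ y ∣ D y ∧ D f = v}) :
    Giraud15NormalFormAt p f := by
  haveI : IsDomain O := isDomain_of_isRegularLocalRing O
  haveI : CharP O p := charP_of_injective_algebraMap (algebraMap (ZMod p) O).injective p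
  have hp : (p : O) ∈ maximalIdeal O := by rw [CharP.cast_eq_zero]; exact Ideal.zero_mem _
  obtain ⟨δ₀, δ₁, h₀x, h₀y, h₁x, h₁y⟩ := exists_dual_pair p hdim hxy
  have hx0 : x ≠ 0 := fun h => by simp [h] at h₀x
  have hy0 : y ≠ 0 := fun h => by simp [h] at h₁y
  rcases exists_unit_generator_of_mem_span p (by omega) (by omega) hf hx0 hy0 δ₀ δ₁ h₀x h₀y h₁x h₁y hJ with h | h | ⟨D₀, hD₀x, hD₀y, hD₀u⟩
  · exact giraud15NormalFormAt_crossing_of_isUnit_generator hp hxy hdim hf ha hb (Or.inl h)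
  · exact giraud15NormalFormAt_crossing_of_isUnit_generator hp hxy hdim hf ha hb (Or.inr h)
  · refine giraud15NormalFormAt_crossing_of_derivations hxy hdim hf ha hb δ₀ δ₁ D₀ ?_ ?_ ?_ ?_ ?_ hD₀u
    · rw [h₀x]; exact (maximalIdeal.isMaximal O).ne_top ∘ (Ideal.eq_top_iff_one _).mpr
    · rw [h₁x]; exact Ideal.zero_mem _
    · rw [h₁y]; exact (maximalIdeal.isMaximal O).ne_top ∘ (Ideal.eq_top_iff_one _).mpr
    · rw [hD₀x]; exact Ideal.zero_mem _
    · rw [hD₀y]; exact Ideal.zero_mem _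

/-- **B7 PART (3), non-crossing: a realiser puts `f` in Giraud normal form.** `f = gᵖ + u·x^a`, `a ≥ 2`, `x^a ∈ J(O, f; log x)` ⇒
`Giraud15NormalFormAt p f`. [cite: Giraud1983, Prop. 1.5 (i) ⇒ (ii), §1.4] -/
theorem giraud15NormalFormAt_noncrossing_of_realiser (p : ℕ) [Fact p.Prime] {O : Type u} [CommRing O] [IsRegularLocalRing O] [Algebra (ZMod p) O]
    [Algebra.FormallySmooth (ZMod p) O] (hdim : ringKrullDim O = 2) {x y f g u : O} {a : ℕ}
    (hxy : Ideal.span {x, y} = maximalIdeal O) (hf : f = g ^ p + u * x ^ a) (ha : 2 ≤ a)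
    (hJ : x ^ a ∈ Ideal.span {v : O | ∃ D : Derivation ℤ O O, x ∣ D x ∧ D f = v}) : Giraud15NormalFormAt p f := by
  haveI : IsDomain O := isDomain_of_isRegularLocalRing O
  haveI : CharP O p := charP_of_injective_algebraMap (algebraMap (ZMod p) O).injective p
  have hp : (p : O) ∈ maximalIdeal O := by rw [CharP.cast_eq_zero]; exact Ideal.zero_mem _
  obtain ⟨δ₀, δ₁, h₀x, h₀y, h₁x, h₁y⟩ := exists_dual_pair p hdim hxy
  have hx0 : x ≠ 0 := fun h => by simp [h] at h₀x
  rcases exists_unit_generator_of_mem_span₁ p (by omega) hf hx0 δ₀ δ₁ h₀x h₁x h₁y hJ with h | h | ⟨D₀, hD₀x, -, hD₀u⟩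
  · exact giraud15NormalFormAt_noncrossing_of_isUnit_generator hp hxy hdim hf ha h
  · refine giraud15NormalFormAt_noncrossing_of_derivations hxy hdim hf ha δ₀ δ₁ ?_ ?_ h
    · rw [h₀x]; exact (maximalIdeal.isMaximal O).ne_top ∘ (Ideal.eq_top_iff_one _).mpr
    · rw [h₁x]; exact Ideal.zero_mem _
  · refine giraud15NormalFormAt_noncrossing_of_derivations hxy hdim hf ha δ₀ D₀ ?_ ?_ hD₀u
    · rw [h₀x]; exact (maximalIdeal.isMaximal O).ne_top ∘ (Ideal.eq_top_iff_one _).mpr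
    · rw [hD₀x]; exact Ideal.zero_mem _

end Regular

end Summit.ResolutionOfSingularities.ResolutionOfSingularities.Theorems.RadicialJung.CleanModels

end
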